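import Summits.AtomisticToContinuum.HydrodynamicLimit.Theorems.AntiMazurCoboundariesCorrectorPressureDecayKiferCanonicalLocalLimit
import Literature.MathematicalPhysics.KineticTheory.HardSphereGibbsGNZSandwich
import Mathlib.InformationTheory.KullbackLeibler.Basic

/-! Scratch: signatures of the c9 wave-1 stubs (elaboration check only). -/

noncomputable section

open MeasureTheory ProbabilityTheory Set Filter Topology InformationTheory
open scoped ENNReal NNReal

namespace Summit.AtomisticToContinuum.HydrodynamicLimit.Theorems.KiferCompactification

open Literature.MathematicalPhysics.KineticTheory (T3 V3 hsDiameter localGibbsLaw blowUpPoint blowUp)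
open Literature.MathematicalPhysics.KineticTheory.HardSphereDLR (gibbsSpecMeasure)
open Literature.MathematicalPhysics.KineticTheory.PointProcess (windowLaw centredBox)
open Literature.Analysis.FluidPDE (HardSphereFlow IsHardCore IsHardSphereGibbs IsTranslationInvariant)
open Literature.Analysis.FunctionSpaces (PointConfig)

/-- S6a: DLR lower bound of the window law of a Gibbs state by the free specification. -/
theorem c9_windowLaw_gibbs_ge_free {z β : ℝ} {u : V3} {G : Measure (PointConfig (V3 × V3))}
    (hz : 0 ≤ z) (hβ : 0 < β) (hG : IsHardSphereGibbs 1 z β u G) {Λ : Set V3} (hΛ : MeasurableSet Λ)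
    (hΛb : Bornology.IsBounded Λ) {A : Set (PointConfig (V3 × V3))} (hA : MeasurableSet A) :
    ENNReal.ofReal (Real.exp (-(z * (volume (Metric.thickening 1 Λ \ Λ)).toReal))) *
        gibbsSpecMeasure 1 z β u Λ ∅ A ≤ windowLaw Λ G A := by
  sorry

/-- S6: the Gibbs reference swap. -/
theorem c9_klDiv_windowLaw_gibbs_le_klDiv_free_add {z β : ℝ} {u : V3} {G : Measure (PointConfig (V3 × V3))}
    (hz : 0 ≤ z) (hβ : 0 < β) (hG : IsHardSphereGibbs 1 z β u G) {Λ : Set V3} (hΛ : MeasurableSet Λ)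
    (hΛb : Bornology.IsBounded Λ) (P : Measure (PointConfig (V3 × V3))) [IsProbabilityMeasure P] :
    klDiv P (windowLaw Λ G) ≤
      klDiv P (gibbsSpecMeasure 1 z β u Λ ∅) + ENNReal.ofReal (z * (volume (Metric.thickening 1 Λ \ Λ)).toReal) := by
  sorry

/-- Chain rule of the relative entropy for product references. -/
theorem c9_klDiv_pi_eq_klDiv_pi_marginals_add_sum {ι : Type*} [Fintype ι] {E : ι → Type*}
    [∀ i, MeasurableSpace (E i)] (P : Measure (∀ i, E i)) [IsProbabilityMeasure P]
    (R : ∀ i, Measure (E i)) [∀ i, IsProbabilityMeasure (R i)] :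
    klDiv P (Measure.pi R) =
      klDiv P (Measure.pi fun i => P.map (Function.eval i)) + ∑ i, klDiv (P.map (Function.eval i)) (R i) := by
  sorry

/-- Uniform-in-N finiteness of the window entropy of the blown-up canonical law against the free block reference. -/
theorem c9_klDiv_windowLaw_canonicalBlowUp_free_le (σ a θ : ℝ) (u₀ : V3) (hσ : 0 < σ) (hσ2 : σ ≤ 1 / 2)
    (ha : 0 < a) (hθ : 0 < θ) {z : ℝ} (hz : 0 < z) (n : ℕ) :
    ∃ C : ℝ, ∀ (N : ℕ) (Φ : HardSphereFlow (Literature.Analysis.FluidPDE.Torus.geometry (Fin 3)) (hsDiameter σ N) (N + 1)),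
      klDiv (windowLaw (centredBox n) (canonicalBlowUpLaw σ a θ u₀ N Φ))
          (gibbsSpecMeasure 1 z θ⁻¹ u₀ (centredBox n) ∅) ≤ ENNReal.ofReal C := by
  sorry

end Summit.AtomisticToContinuum.HydrodynamicLimit.Theorems.KiferCompactification

end
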